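import Mathlib
import Summits.Ventures.HodgeRepro2.T5MuInvariantDVR
import Summits.Ventures.HodgeRepro2.T5AmiceIsometry
import Summits.Ventures.HodgeRepro2.T5LambdaInvariantDVR

/-!
# T5MuInvariantDVRAmice — the S4 ↔ S5 bridge over W in the valuation vocabulary:
μ(m) «inf over opens» = μ(f_m) «min valuation of the coefficients» for a W-valued measure on ℤ_p

Tier-5 support for route-3's §G (route/T5-CHECK-G-p7.md §21.1): S4 computes the μ-invariant of the
𝔭-line measure as an infimum over opens (T5MuInvariantDVR's `muV`, valued in ℕ∞ through
`addVal`), S5 reads the same measure as a power series f_m ∈ W[[T]] and applies the Weierstrass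
preparation theorem [P3] with the exponent μ(f_m) = min_n v(coeff_n f_m) (T5LambdaInvariantDVR's
`muSeries`).  §74 (T5MuInvariantAmice) identified the two numbers for ℤ_p-VALUED measures; this
file does it for measures with values in any complete discrete valuation ring `A` whose norm is a
function of the valuation (`NormDict A r`, e.g. W = W(𝔽̄_p) with r = p⁻¹): **`muV_eq_muSeries_amice`**
(μ(m) = μ(f_m)), through the isometry of the Amice transform (§73: the coefficients of f_m are the
values of m on the Mahler basis, and a bound on them bounds m).  Consequences:
`muV_eq_top_iff_amice_eq_zero` (μ(m) = ∞ ⟺ f_m = 0), `exists_addVal_coeff_eq_muV` (the infimum is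
attained on a coefficient), `natCast_le_muV_iff_forall_coeff` (n ≤ μ(m) ⟺ ϖ^n divides every
coefficient, in valuation form).

No printed input is consumed.  §8(d): uses an L-value-free non-vanishing device: NO.
-/

namespace Summit.Ventures.HodgeRepro2.T5MuInvariantDVRAmice

open Summit.Ventures.HodgeRepro2.T5MuInvariantDVR
open Summit.Ventures.HodgeRepro2.T5AmiceTransform (amice coeff_amice continuous_of_bound)
open Summit.Ventures.HodgeRepro2.T5AmiceIsometry (norm_map_le_of_forall_norm_coeff_le)
open Summit.Ventures.HodgeRepro2.T5LambdaInvariantDVR (muSeries)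
open IsDiscreteValuationRing (addVal)

variable {p : ℕ} [Fact (Nat.Prime p)]
variable {A : Type*} [NormedCommRing A] [IsDomain A] [IsDiscreteValuationRing A]

/-- Under the dictionary every continuous `φ : ℤ_p → A` has sup norm `≤ 1`. -/
theorem norm_le_one_of_normDict {r : ℝ} (hd : NormDict A r) (φ : C(ℤ_[p], A)) : ‖φ‖ ≤ 1 :=
  (ContinuousMap.norm_le φ zero_le_one).2 fun x => hd.norm_le_one (φ x)

variable [Algebra ℤ_[p] A] [IsBoundedSMul ℤ_[p] A] [IsUltrametricDist A] [CompleteSpace A]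

/-- `n ≤ μ(m)` iff `n ≤ v(coeff_k f_m)` for every `k`: the valuation bound on the values of `m`
is the valuation bound on the coefficients of its Amice transform (the coefficients ARE values of
`m`, and conversely a bound on the coefficients bounds `m` by §73's isometry). -/
theorem natCast_le_muV_iff_forall_coeff {r : ℝ} (hd : NormDict A r) (m : C(ℤ_[p], A) →ₗ[A] A)
    {C : ℝ} (hC : 0 ≤ C) (hm : ∀ φ : C(ℤ_[p], A), ‖m φ‖ ≤ C * ‖φ‖) (n : ℕ) :
    (n : ℕ∞) ≤ muV m ↔ ∀ k : ℕ, (n : ℕ∞) ≤ addVal A (PowerSeries.coeff k (amice m)) := by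
  rw [natCast_le_muV_iff_norm_le hd m hC hm]
  constructor
  · intro h k
    rw [← hd.norm_le_pow_iff, coeff_amice]
    exact h _
  · intro h φ
    have hcoef : ∀ k : ℕ, ‖PowerSeries.coeff k (amice m)‖ ≤ r ^ n :=
      fun k => (hd.norm_le_pow_iff _ _).2 (h k)
    calc ‖m φ‖ ≤ r ^ n * ‖φ‖ :=
          norm_map_le_of_forall_norm_coeff_le m (continuous_of_bound m C hm)
            (pow_nonneg hd.nonneg n) hcoef φ
      _ ≤ r ^ n * 1 :=
          mul_le_mul_of_nonneg_left (norm_le_one_of_normDict hd φ) (pow_nonneg hd.nonneg n)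
      _ = r ^ n := mul_one _

/-- THE TWO μ-INVARIANTS AGREE OVER W: `μ(m)` (inf over opens, S4) `= μ(f_m)` (min valuation of
the coefficients of the Amice transform, the exponent of S5's Weierstrass factorisation). -/
theorem muV_eq_muSeries_amice {r : ℝ} (hd : NormDict A r) (m : C(ℤ_[p], A) →ₗ[A] A) {C : ℝ}
    (hC : 0 ≤ C) (hm : ∀ φ : C(ℤ_[p], A), ‖m φ‖ ≤ C * ‖φ‖) :
    muV m = muSeries (amice m) := by
  unfold muSeries
  apply le_antisymm
  · refine le_iInf fun k => ?_
    rw [← iInf_addVal_apply_eq_muV hd m hC hm, coeff_amice]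
    exact iInf_le (fun φ : C(ℤ_[p], A) => addVal A (m φ)) _
  · refine T5MuInvariantPadic.le_of_forall_natCast_le fun n hn => ?_
    rw [natCast_le_muV_iff_forall_coeff hd m hC hm n]
    exact fun k => hn.trans (iInf_le (fun k : ℕ => addVal A (PowerSeries.coeff k (amice m))) k)

/-- `μ(m) = ∞ ⟺ f_m = 0` (⟺ `m = 0`, §62). -/
theorem muV_eq_top_iff_amice_eq_zero {r : ℝ} (hd : NormDict A r) (m : C(ℤ_[p], A) →ₗ[A] A)
    {C : ℝ} (hC : 0 ≤ C) (hm : ∀ φ : C(ℤ_[p], A), ‖m φ‖ ≤ C * ‖φ‖) :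
    muV m = ⊤ ↔ amice m = 0 := by
  rw [muV_eq_muSeries_amice hd m hC hm]
  exact T5LambdaInvariantDVR.muSeries_eq_top_iff _

/-- The infimum defining `μ(m)` is attained on a coefficient of `f_m`: `∃ n, v(coeff_n f_m) = μ(m)`
— the normalisation `f_m = ϖ^{μ}·g` with `g ≢ 0 mod ϖ` of S5 (§83's
`exists_addVal_coeff_eq_muSeries`). -/
theorem exists_addVal_coeff_eq_muV {r : ℝ} (hd : NormDict A r) (m : C(ℤ_[p], A) →ₗ[A] A)
    {C : ℝ} (hC : 0 ≤ C) (hm : ∀ φ : C(ℤ_[p], A), ‖m φ‖ ≤ C * ‖φ‖) :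
    ∃ n : ℕ, addVal A (PowerSeries.coeff n (amice m)) = muV m := by
  rw [muV_eq_muSeries_amice hd m hC hm]
  exact T5LambdaInvariantDVR.exists_addVal_coeff_eq_muSeries _

/-- `μ(m) ≤ v(coeff_n f_m)` for every `n`. -/
theorem muV_le_addVal_coeff {r : ℝ} (hd : NormDict A r) (m : C(ℤ_[p], A) →ₗ[A] A) {C : ℝ}
    (hC : 0 ≤ C) (hm : ∀ φ : C(ℤ_[p], A), ‖m φ‖ ≤ C * ‖φ‖) (n : ℕ) :
    muV m ≤ addVal A (PowerSeries.coeff n (amice m)) := by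
  rw [muV_eq_muSeries_amice hd m hC hm]
  exact T5LambdaInvariantDVR.muSeries_le _ _

end Summit.Ventures.HodgeRepro2.T5MuInvariantDVRAmice
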